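/-
Copyright (c) 2026 the pub-hodgecm-mathlib formalisation cell (harness21).  Prover seat hodgecm-mathlib-LH4-p10 (g2), req620 Track A «(D-RAM) FOUR-FRAME» squad
(heir LEAD F0P3a-plan lineage; dealer LH4-plan lineage; MS ROAD A, Stage B brick B5 (i) of SPEC `F0/P3c/LH4/LH4-p10/g2/SPEC-StageB.v1.LH4p10g2.md`).  2026-09-04.
-/
import Literature.NumberTheory.Automorphic.UnitaryLatticeTreeAxisEndoFrame                 -- ★ `isVertexLattice_latt_iff_of_v`; brings `isIntMatrix_nonsing_inv_of_v_det_eq_one`, `isIntMatrix_smul_of_v_le_one`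
import Literature.NumberTheory.Automorphic.UnitaryLatticeTreeApartment                    -- ★ `dualLatt_eq_self_of_isSelfDualLattice`
import Summits.HodgeConjecture.HodgeConjecture.Theorems.F0P3cDyRamDiagonalTorusDefs         -- ★ `IsDualisableLattice`
import Summits.HodgeConjecture.HodgeConjecture.Theorems.F0P3cDyRamDiagonalStableLatticeHNF  -- ★ p855280 `mem_latt_hnf_iff`, `latt_hnf_le_stdLattice`
import HarnessLib

/-!
# Crux `H413`, MS ROAD A, STAGE B brick B5 (i): «GLUED TUBE STRATA — THE DUALISABILITY CRITERION (R)»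

Cell `hodgecm-mathlib` (D-0151), FLOOR 0, crux item H413 = `stmt-HodgeConjecture-24833`; lane `--supports stmt-HodgeConjecture-24833 --as helper` (count-neutral).  THEOREMS ONLY.
LH4-p10 (g2) MEMO v2 §4 (`F0/P3c/LH4/LH4-p10/g2/MEMO-stableLaw-finite.v2.LH4p10g2.md` 4311037997971aa2): in the (S-fin) count of the stable four-frame law, the lattices of the
GLUED stratum `G₁(2ρ, 2t)` are `M = latt V`, `V = (1 0 0; x ϖ^ρ 0; xζ + y″ ϖ^ρζ ϖ^{2ρ+2t})` with units `x, ζ` and `|y″| = |ϖ|^{2t}` (`ρ, t ≥ 1`).  THIS FILE: such an `M` is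
DUALISABLE (self-dual for SOME `σ`-fixed non-degenerate diagonal form) **iff (R): `ζ·σ(y″)∕σ(x)` is congruent to a `σ`-fixed element modulo `𝔭^{ρ+2t}`** — a criterion that does not
mention the group element `γ`, only the involution.  Hypotheses: `σ` an involution with `|σ·| = |·|`, `ϖ ≠ 0`, `|ϖ| < 1`, and the WILD TRACE BOUND `|a + σ a| ≤ |ϖ|·|a|` (holds for every
ramified quadratic datum with `d ≥ 2` under the dyadic fence; Stage B brick B0 discharges it).
* `formCongr_hnf_diagonal` — the Gram matrix of `diag D` on the HNF frame, nine explicit entries.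
* `isDualisableLattice_latt_hnf_glued_imp` — dualisable ⟹ (R) (axis `M ∩ Ee₃ = 𝔭^{2ρ+2t}` pins `|D₃|`, then the Gram entry `G₀₁` IS (R)).
* `isDualisableLattice_latt_hnf_glued_of` — (R) ⟹ dualisable (explicit `D = (−D₂(Nx + wNy), π₀^{−(ρ+t)}, w·π₀^{−(ρ+t)})`, `w = −1∕(Nζ + f)`, `π₀ = ϖσϖ`).
* **`isDualisableLattice_latt_hnf_glued_iff`** — the criterion.
HONEST LABEL.  Count-neutral; the census laws stay PROVER TARGETS until the MS assembly lands; `HC_CM` is proved only modulo the 7 printed citations (2 remaining named inputs: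
hLiu418 = `stmt-HodgeConjecture-24832`, h413 = `stmt-HodgeConjecture-24833`) until rung 0 closes.

## References
* [Jacobowitz1962] R. Jacobowitz, *Hermitian forms over local fields*, Amer. J. Math. 84 (1962), §4, §7 (Gram matrices, unimodular lattices, dual bases).
* [Kottwitz1986BaseChangeUnits] R. Kottwitz, *Base change for unit elements of Hecke algebras*, Compositio Math. 60 (1986), §1 pp. 240–241 (fixed-lattice counting).
* [Serre1980Trees] J.-P. Serre, *Trees*, Springer (1980), Ch. II §1.1 (lattices `g·𝒪^N`, Hermite normal form).
-/

set_option autoImplicit false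

noncomputable section

namespace Summit.HodgeConjecture.HodgeConjecture.Cruxes.H413.F0P3cDyRamDiagonalGluedTubeCriterion

open Matrix
open Literature.NumberTheory.Automorphic Literature.NumberTheory.Automorphic.HermitianLattice Literature.NumberTheory.Automorphic.UnitaryGroup
open Literature.NumberTheory.Automorphic.UnitaryLatticeTree
open Summit.HodgeConjecture.HodgeConjecture.Cruxes.H413.F0P3cDyRamDiagonalTorusDefs
open Summit.HodgeConjecture.HodgeConjecture.Cruxes.H413.F0P3cDyRamDiagonalStableLatticeHNF
open scoped Valued WithZero Matrix MatrixGroups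

variable {K : Type*} [Field K] [Valued K ℤᵐ⁰]

/-! ## §1  The Gram matrix of a diagonal form on the HNF frame -/

omit [Valued K ℤᵐ⁰] in
/-- **The Gram matrix `(σV)ᵀ·diag D·V` of the HNF frame `V = (1 0 0; x p 0; y z r)`**, nine entries. [cite: Jacobowitz1962, §4] -/
theorem formCongr_hnf_diagonal (σ : K →+* K) (D : Fin 3 → K) (x y z p r : K) (V : GL (Fin 3) K)
    (hV : (V : Matrix (Fin 3) (Fin 3) K) = !![1, 0, 0; x, p, 0; y, z, r]) :
    formCongr σ V (Matrix.diagonal D) =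
      !![D 0 + σ x * D 1 * x + σ y * D 2 * y, σ x * D 1 * p + σ y * D 2 * z, σ y * D 2 * r;
         σ p * D 1 * x + σ z * D 2 * y, σ p * D 1 * p + σ z * D 2 * z, σ z * D 2 * r;
         σ r * D 2 * y, σ r * D 2 * z, σ r * D 2 * r] := by
  rw [formCongr, hV]
  ext i j
  fin_cases i <;> fin_cases j <;>
    simp [Matrix.mul_apply, Fin.sum_univ_three, Matrix.diagonal, Matrix.transpose_apply, Matrix.map_apply]

omit [Valued K ℤᵐ⁰] in
/-- `det V = p·r` for the HNF frame. [cite: Serre1980Trees, Ch. II §1.1] -/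
theorem det_coe_hnf (x y z p r : K) (V : GL (Fin 3) K) (hV : (V : Matrix (Fin 3) (Fin 3) K) = !![1, 0, 0; x, p, 0; y, z, r]) :
    (V : Matrix (Fin 3) (Fin 3) K).det = p * r := by
  rw [hV, Matrix.det_fin_three]; simp

omit [Valued K ℤᵐ⁰] in
/-- `det((σV)ᵀ diag D V) = σ(det V)·(D₀D₁D₂)·det V`. [cite: Jacobowitz1962, §4] -/
theorem det_formCongr_diagonal (σ : K →+* K) (D : Fin 3 → K) (V : GL (Fin 3) K) :
    (formCongr σ V (Matrix.diagonal D)).det = σ (V : Matrix (Fin 3) (Fin 3) K).det * (D 0 * D 1 * D 2) * (V : Matrix (Fin 3) (Fin 3) K).det := by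
  rw [formCongr, Matrix.det_mul, Matrix.det_mul, Matrix.det_transpose, Matrix.det_diagonal, Fin.prod_univ_three]
  congr 2
  rw [← RingHom.mapMatrix_apply, RingHom.map_det]

/-! ## §2  Valuation bookkeeping -/

/-- Ultrametric equality: `|a + b| = |a|` when `|b| < |a|`. [cite: Serre1980Trees, Ch. II §1.1] -/
theorem v_add_eq_of_lt {a b : K} (h : Valued.v b < Valued.v a) : Valued.v (a + b) = Valued.v a := by
  exact Valuation.map_add_eq_of_lt_left _ h

/-! ## §3  Dualisable ⟹ (R) -/

/-- **AXIS `e₃`**: `t·e₃ ∈ latt V` iff `|t| ≤ |r|` (`V` the HNF frame with `p, r ≠ 0`). [cite: Serre1980Trees, Ch. II §1.1] -/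
theorem single_two_mem_latt_hnf_iff (x y z : K) {p r : K} (hp : p ≠ 0) (hr : r ≠ 0) (t : K) :
    Pi.single (2 : Fin 3) t ∈ latt (Matrix.of ![![1, 0, 0], ![x, p, 0], ![y, z, r]]) ↔ Valued.v t ≤ Valued.v r := by
  rw [mem_latt_hnf_iff x y z hp hr]
  have hvp : 0 < Valued.v p := (Valuation.pos_iff _).2 hp
  have h0 : (Pi.single (2 : Fin 3) t : Fin 3 → K) 0 = 0 := by simp
  have h1 : (Pi.single (2 : Fin 3) t : Fin 3 → K) 1 = 0 := by simp
  have h2 : (Pi.single (2 : Fin 3) t : Fin 3 → K) 2 = t := by simp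
  rw [h0, h1, h2]
  simp only [mul_zero, sub_zero, map_zero, zero_le, true_and]
  rw [map_mul, map_mul, mul_comm (Valued.v p) (Valued.v r)]
  exact mul_le_mul_iff_left₀ hvp

/-- **DUALISABLE ⟹ (R)**: if `latt V` (glued stratum) is self-dual for a `σ`-fixed non-degenerate diagonal form `diag D`, then `|D₂| ≥ |ϖ|^{−(2ρ+2t)}` (the vector
`D₂⁻¹e₃` lies in the dual, hence in the lattice, hence on the axis `𝔭^{2ρ+2t}e₃`) and the Gram entry `G₀₁ = ϖ^ρ·D₂·(ζσy″ − σx·f)` with the FIXED `f = −(D₁ + D₂Nζ)∕D₂` is integral —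
which is (R). [cite: Jacobowitz1962, §7] [cite: Kottwitz1986BaseChangeUnits, §1 pp. 240–241] -/
theorem isDualisableLattice_latt_hnf_glued_imp {σ : K →+* K} (hσ : ∀ a, σ (σ a) = a) (hvσ : ∀ a, Valued.v (σ a) = Valued.v a)
    {ϖ : K} (hϖ0 : ϖ ≠ 0) (hϖ1 : Valued.v ϖ ≤ 1) (ρ t : ℕ) {x ζ y'' : K} (hx : Valued.v x = 1) (hζ : Valued.v ζ ≤ 1) (hy'' : Valued.v y'' ≤ 1)
    (V : GL (Fin 3) K) (hV : (V : Matrix (Fin 3) (Fin 3) K) = !![1, 0, 0; x, ϖ ^ ρ, 0; x * ζ + y'', ϖ ^ ρ * ζ, ϖ ^ (2 * ρ + 2 * t)])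
    (hM : IsDualisableLattice σ ϖ (latt (V : Matrix (Fin 3) (Fin 3) K))) :
    ∃ f : K, σ f = f ∧ Valued.v (ζ * σ y'' - σ x * f) ≤ Valued.v ϖ ^ (ρ + 2 * t) := by
  obtain ⟨D, hD, hvert⟩ := hM
  set c : ℕ := 2 * ρ + 2 * t with hc
  have hpc : (ϖ ^ ρ : K) ≠ 0 := pow_ne_zero _ hϖ0
  have hrc : (ϖ ^ c : K) ≠ 0 := pow_ne_zero _ hϖ0
  have hD2 : D 2 ≠ 0 := (hD 2).2
  have hdetD : IsUnit (Matrix.diagonal D).det := by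
    rw [Matrix.det_diagonal, Fin.prod_univ_three]
    exact (mul_ne_zero (mul_ne_zero (hD 0).2 (hD 1).2) hD2).isUnit
  -- the lattice is integral
  have hy : Valued.v (x * ζ + y'') ≤ 1 :=
    (Valuation.map_add _ _ _).trans (max_le (by rw [map_mul, hx, one_mul]; exact hζ) hy'')
  have hint : ∀ m ∈ latt (V : Matrix (Fin 3) (Fin 3) K), ∀ i, Valued.v (m i) ≤ 1 := by
    intro m hm i
    rw [hV] at hm
    have hle := latt_hnf_le_stdLattice (x := x) (y := x * ζ + y'') (z := ϖ ^ ρ * ζ) (p := ϖ ^ ρ) (r := ϖ ^ c) hx.le hy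
      (by rw [map_mul, map_pow]; exact mul_le_one' (pow_le_one' hϖ1 _) hζ) (by rw [map_pow]; exact pow_le_one' hϖ1 _) (by rw [map_pow]; exact pow_le_one' hϖ1 _)
    exact (mem_stdLattice.1 (hle hm)) i
  -- `D₂⁻¹ e₃` lies in the dual lattice, which is the lattice itself
  have hdual : dualLatt σ (Matrix.diagonal D) (latt (V : Matrix (Fin 3) (Fin 3) K)) = latt (V : Matrix (Fin 3) (Fin 3) K) :=
    dualLatt_eq_self_of_isSelfDualLattice hvσ hdetD hvert
  have hw : Pi.single (2 : Fin 3) (D 2)⁻¹ ∈ latt (V : Matrix (Fin 3) (Fin 3) K) := by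
    rw [← hdual, mem_dualLatt]
    intro m hm
    rw [pairing_apply]
    have hsum : ∑ i : Fin 3, ∑ j : Fin 3, σ (m i) * Matrix.diagonal D i j * (Pi.single (2 : Fin 3) (D 2)⁻¹ : Fin 3 → K) j = σ (m 2) := by
      simp [Matrix.diagonal, Pi.single_apply, hD2]
    rw [hsum, hvσ]
    exact hint m hm 2
  have hD2v : Valued.v (D 2)⁻¹ ≤ Valued.v ϖ ^ c := by
    rw [hV] at hw
    have := (single_two_mem_latt_hnf_iff x (x * ζ + y'') (ϖ ^ ρ * ζ) hpc hrc _).1 hw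
    rwa [map_pow] at this
  -- the Gram entry `G₀₁`
  have hG := ((isVertexLattice_latt_iff_of_v σ hvσ hϖ0 (Matrix.diagonal D) 0 V).1 hvert).1
  have h01 := hG 0 1
  rw [formCongr_hnf_diagonal σ D x (x * ζ + y'') (ϖ ^ ρ * ζ) (ϖ ^ ρ) (ϖ ^ c) V hV] at h01
  simp only [Matrix.of_apply, Matrix.cons_val', Matrix.cons_val_zero, Matrix.cons_val_one, Matrix.empty_val', Matrix.cons_val_fin_one] at h01
  -- rewrite `G₀₁ = ϖ^ρ · D₂ · (ζσy″ − σx·f)` with `f = −(D₁ + D₂ ζ σζ)∕D₂`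
  refine ⟨-(D 1 + D 2 * (ζ * σ ζ)) / D 2, ?_, ?_⟩
  · rw [map_div₀, map_neg, map_add, map_mul, map_mul, hσ, (hD 1).1, (hD 2).1, mul_comm (σ ζ) ζ]
  · have hrew : σ x * D 1 * ϖ ^ ρ + σ (x * ζ + y'') * D 2 * (ϖ ^ ρ * ζ) = ϖ ^ ρ * D 2 * (ζ * σ y'' - σ x * (-(D 1 + D 2 * (ζ * σ ζ)) / D 2)) := by
      rw [map_add, map_mul]; field_simp; ring
    rw [hrew, map_mul, map_mul, map_pow] at h01
    -- `|ϖ|^ρ |D₂| |…| ≤ 1` and `|D₂|⁻¹ ≤ |ϖ|^c`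
    have hD2pos : 0 < Valued.v (D 2) := (Valuation.pos_iff _).2 hD2
    have hϖρpos : 0 < Valued.v ϖ ^ ρ := pow_pos ((Valuation.pos_iff _).2 hϖ0) _
    rw [map_inv₀] at hD2v
    have key : Valued.v (ζ * σ y'' - σ x * (-(D 1 + D 2 * (ζ * σ ζ)) / D 2)) ≤ (Valued.v ϖ ^ ρ * Valued.v (D 2))⁻¹ := by
      rw [← one_mul (Valued.v ϖ ^ ρ * Valued.v (D 2))⁻¹, le_mul_inv_iff₀ (mul_pos hϖρpos hD2pos)]
      calc Valued.v (ζ * σ y'' - σ x * (-(D 1 + D 2 * (ζ * σ ζ)) / D 2)) * (Valued.v ϖ ^ ρ * Valued.v (D 2))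
          = Valued.v ϖ ^ ρ * Valued.v (D 2) * Valued.v (ζ * σ y'' - σ x * (-(D 1 + D 2 * (ζ * σ ζ)) / D 2)) := mul_comm _ _
        _ ≤ 1 := h01
    refine key.trans ?_
    rw [mul_inv]
    calc (Valued.v ϖ ^ ρ)⁻¹ * (Valued.v (D 2))⁻¹ ≤ (Valued.v ϖ ^ ρ)⁻¹ * Valued.v ϖ ^ c := mul_le_mul_right hD2v _
      _ = Valued.v ϖ ^ (ρ + 2 * t) := by
          rw [hc, show 2 * ρ + 2 * t = ρ + (ρ + 2 * t) by ring, pow_add, inv_mul_cancel_left₀ hϖρpos.ne']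


/-! ## §4  (R) ⟹ dualisable: the explicit form -/

/-- An explicit `3 × 3` matrix with integral entries is integral. [cite: Serre1980Trees, Ch. II §1.1] -/
theorem isIntMatrix_of_fin_three {a₀₀ a₀₁ a₀₂ a₁₀ a₁₁ a₁₂ a₂₀ a₂₁ a₂₂ : K}
    (h₀₀ : Valued.v a₀₀ ≤ 1) (h₀₁ : Valued.v a₀₁ ≤ 1) (h₀₂ : Valued.v a₀₂ ≤ 1) (h₁₀ : Valued.v a₁₀ ≤ 1) (h₁₁ : Valued.v a₁₁ ≤ 1)
    (h₁₂ : Valued.v a₁₂ ≤ 1) (h₂₀ : Valued.v a₂₀ ≤ 1) (h₂₁ : Valued.v a₂₁ ≤ 1) (h₂₂ : Valued.v a₂₂ ≤ 1) :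
    IsIntMatrix (!![a₀₀, a₀₁, a₀₂; a₁₀, a₁₁, a₁₂; a₂₀, a₂₁, a₂₂] : Matrix (Fin 3) (Fin 3) K) := by
  intro i j
  fin_cases i <;> fin_cases j
  exacts [h₀₀, h₀₁, h₀₂, h₁₀, h₁₁, h₁₂, h₂₀, h₂₁, h₂₂]

/-- **(R) ⟹ DUALISABLE**: if `ζσ(y″) ≡ σ(x)·f (𝔭^{ρ+2t})` for a FIXED `f`, then with `w := −1∕(Nζ + f)`, `π₀ := ϖσϖ` and the fixed diagonal form
`D = (−(D₁Nx + D₂Ny), π₀^{−(ρ+t)}, w·π₀^{−(ρ+t)})` the glued-stratum lattice `latt V` is self-dual: the Gram matrix is integral with unit determinant (`|Nx + wNy| = |ϖ|^{2t}` by the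
wild trace bound). [cite: Jacobowitz1962, §7] [cite: Kottwitz1986BaseChangeUnits, §1 pp. 240–241] -/
theorem isDualisableLattice_latt_hnf_glued_of {σ : K →+* K} (hσ : ∀ a, σ (σ a) = a) (hvσ : ∀ a, Valued.v (σ a) = Valued.v a)
    {ϖ : K} (hϖ0 : ϖ ≠ 0) (hϖ1 : Valued.v ϖ < 1) (hTr : ∀ a : K, Valued.v (a + σ a) ≤ Valued.v ϖ * Valued.v a)
    (ρ t : ℕ) (hρ : 1 ≤ ρ) (ht : 1 ≤ t) {x ζ y'' : K} (hx : Valued.v x = 1) (hζ : Valued.v ζ = 1) (hy'' : Valued.v y'' = Valued.v ϖ ^ (2 * t))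
    (V : GL (Fin 3) K) (hV : (V : Matrix (Fin 3) (Fin 3) K) = !![1, 0, 0; x, ϖ ^ ρ, 0; x * ζ + y'', ϖ ^ ρ * ζ, ϖ ^ (2 * ρ + 2 * t)])
    {f : K} (hf : σ f = f) (hR : Valued.v (ζ * σ y'' - σ x * f) ≤ Valued.v ϖ ^ (ρ + 2 * t)) :
    IsDualisableLattice σ ϖ (latt (V : Matrix (Fin 3) (Fin 3) K)) := by
  set c : ℕ := 2 * ρ + 2 * t with hc
  have hvϖ : 0 < Valued.v ϖ := (Valuation.pos_iff _).2 hϖ0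
  have hϖ1' : Valued.v ϖ ≤ 1 := hϖ1.le
  have hvϖc : Valued.v ϖ ^ c ≠ 0 := pow_ne_zero _ hvϖ.ne'
  -- `|f| = |ϖ|^{2t}`
  have h1 : Valued.v (ζ * σ y'') = Valued.v ϖ ^ (2 * t) := by rw [map_mul, hζ, hvσ, hy'', one_mul]
  have hlt : Valued.v (ζ * σ y'' - σ x * f) < Valued.v (ζ * σ y'') :=
    hR.trans_lt (by rw [h1]; exact pow_lt_pow_right_of_lt_one₀ hvϖ hϖ1 (by omega))
  have hvxf : Valued.v (σ x * f) = Valued.v (ζ * σ y'') := by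
    have e : σ x * f = ζ * σ y'' + -(ζ * σ y'' - σ x * f) := by ring
    rw [e]
    exact Valuation.map_add_eq_of_lt_left _ (by rwa [Valuation.map_neg])
  have hvf : Valued.v f = Valued.v ϖ ^ (2 * t) := by rw [map_mul, hvσ, hx, one_mul] at hvxf; exact hvxf.trans h1
  have hfv : Valued.v f < 1 := by rw [hvf]; exact pow_lt_one₀ zero_le hϖ1 (by omega)
  -- the unit `Nζ + f` and `w`
  set Nζ : K := ζ * σ ζ with hNζ
  have hvNζ : Valued.v Nζ = 1 := by rw [hNζ, map_mul, hvσ, hζ, one_mul]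
  have hvNf : Valued.v (Nζ + f) = 1 := by rw [v_add_eq_of_lt (by rw [hvNζ]; exact hfv), hvNζ]
  have hNf0 : Nζ + f ≠ 0 := fun h => by rw [h, map_zero] at hvNf; exact zero_ne_one hvNf
  set w : K := -(Nζ + f)⁻¹ with hw
  have hσNζ : σ Nζ = Nζ := by rw [hNζ, map_mul, hσ, mul_comm]
  have hσw : σ w = w := by rw [hw, map_neg, map_inv₀, map_add, hσNζ, hf]
  have hvw : Valued.v w = 1 := by rw [hw, Valuation.map_neg, map_inv₀, hvNf, inv_one]
  have hw0 : w ≠ 0 := fun h => by rw [h, map_zero] at hvw; exact zero_ne_one hvw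
  have hε : 1 + w * Nζ = -(w * f) := by rw [hw]; field_simp; ring
  -- the uniformiser of `F` and the form
  set π₀ : K := ϖ * σ ϖ with hπ₀
  have hσπ₀ : σ π₀ = π₀ := by rw [hπ₀, map_mul, hσ, mul_comm]
  have hvπ₀ : Valued.v π₀ = Valued.v ϖ ^ 2 := by rw [hπ₀, map_mul, hvσ, sq]
  have hσϖ0 : σ ϖ ≠ 0 := fun h => hϖ0 (by rw [← hσ ϖ, h, map_zero])
  have hπ₀0 : π₀ ≠ 0 := mul_ne_zero hϖ0 hσϖ0
  set y : K := x * ζ + y'' with hy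
  set D₁ : K := (π₀ ^ (ρ + t))⁻¹ with hD₁
  set D₂ : K := w * D₁ with hD₂
  set D₀ : K := -(D₁ * (σ x * x) + D₂ * (σ y * y)) with hD₀
  have hvD₁ : Valued.v D₁ = (Valued.v ϖ ^ c)⁻¹ := by
    rw [hD₁, map_inv₀, map_pow, hvπ₀, ← pow_mul, hc]; congr 2; ring
  have hvD₂ : Valued.v D₂ = (Valued.v ϖ ^ c)⁻¹ := by rw [hD₂, map_mul, hvw, one_mul, hvD₁]
  have hD₁0 : D₁ ≠ 0 := by rw [hD₁]; exact inv_ne_zero (pow_ne_zero _ hπ₀0)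
  have hD₂0 : D₂ ≠ 0 := mul_ne_zero hw0 hD₁0
  have hσD₁ : σ D₁ = D₁ := by rw [hD₁, map_inv₀, map_pow, hσπ₀]
  have hσD₂ : σ D₂ = D₂ := by rw [hD₂, map_mul, hσw, hσD₁]
  have hσD₀ : σ D₀ = D₀ := by
    rw [hD₀]; simp only [map_neg, map_add, map_mul, hσ, hσD₁, hσD₂]; ring
  -- valuations of the data
  have hvy : Valued.v y ≤ 1 := by
    rw [hy]; refine (Valuation.map_add _ _ _).trans (max_le ?_ ?_)
    · rw [map_mul, hx, hζ, one_mul]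
    · rw [hy'']; exact pow_le_one₀ zero_le hϖ1'
  -- (k1) the glued entry: `D₁σx + D₂ζσy = D₁·w·(ζσy″ − σx·f)`
  have hk1 : D₁ * σ x + D₂ * ζ * σ y = D₁ * w * (ζ * σ y'' - σ x * f) := by
    have e1 : D₁ * σ x + D₂ * ζ * σ y = D₁ * (σ x * (1 + w * Nζ) + w * ζ * σ y'') := by
      rw [hD₂, hy, map_add, map_mul, hNζ]; ring
    rw [e1, hε]; ring
  have hvk1 : Valued.v (D₁ * σ x + D₂ * ζ * σ y) * Valued.v ϖ ^ ρ ≤ 1 := by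
    rw [hk1, map_mul, map_mul, hvD₁, hvw, mul_one]
    have hAB : Valued.v (ζ * σ y'' - σ x * f) * Valued.v ϖ ^ ρ ≤ Valued.v ϖ ^ c :=
      calc Valued.v (ζ * σ y'' - σ x * f) * Valued.v ϖ ^ ρ ≤ Valued.v ϖ ^ (ρ + 2 * t) * Valued.v ϖ ^ ρ := mul_le_mul_left hR _
        _ = Valued.v ϖ ^ c := by rw [← pow_add, hc]; congr 1; ring
    calc (Valued.v ϖ ^ c)⁻¹ * Valued.v (ζ * σ y'' - σ x * f) * Valued.v ϖ ^ ρ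
        = (Valued.v ϖ ^ c)⁻¹ * (Valued.v (ζ * σ y'' - σ x * f) * Valued.v ϖ ^ ρ) := mul_assoc _ _ _
      _ ≤ (Valued.v ϖ ^ c)⁻¹ * Valued.v ϖ ^ c := mul_le_mul_right hAB _
      _ = 1 := inv_mul_cancel₀ hvϖc
  -- (k2) the second diagonal entry: `σ(ϖ^ρ)D₁ϖ^ρ + σ(ϖ^ρζ)D₂ϖ^ρζ = π₀^ρ·D₁·(1 + wNζ)`
  have hk2 : σ (ϖ ^ ρ) * D₁ * ϖ ^ ρ + σ (ϖ ^ ρ * ζ) * D₂ * (ϖ ^ ρ * ζ) = -(π₀ ^ ρ * D₁ * w * f) := by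
    have e : σ (ϖ ^ ρ) * D₁ * ϖ ^ ρ + σ (ϖ ^ ρ * ζ) * D₂ * (ϖ ^ ρ * ζ) = π₀ ^ ρ * D₁ * (1 + w * Nζ) := by
      rw [hD₂, hNζ, hπ₀, map_mul, map_pow, mul_pow]; ring
    rw [e, hε]; ring
  have hvk2 : Valued.v (σ (ϖ ^ ρ) * D₁ * ϖ ^ ρ + σ (ϖ ^ ρ * ζ) * D₂ * (ϖ ^ ρ * ζ)) ≤ 1 := by
    rw [hk2, Valuation.map_neg, map_mul Valued.v (π₀ ^ ρ * D₁ * w) f, map_mul Valued.v (π₀ ^ ρ * D₁) w, map_mul Valued.v (π₀ ^ ρ) D₁, map_pow, hvπ₀, hvD₁, hvw,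
      hvf, mul_one, ← pow_mul]
    have e2 : Valued.v ϖ ^ c = Valued.v ϖ ^ (2 * ρ) * Valued.v ϖ ^ (2 * t) := by rw [← pow_add]
    rw [e2, mul_inv]
    calc Valued.v ϖ ^ (2 * ρ) * ((Valued.v ϖ ^ (2 * ρ))⁻¹ * (Valued.v ϖ ^ (2 * t))⁻¹) * Valued.v ϖ ^ (2 * t)
        = (Valued.v ϖ ^ (2 * ρ) * (Valued.v ϖ ^ (2 * ρ))⁻¹) * ((Valued.v ϖ ^ (2 * t))⁻¹ * Valued.v ϖ ^ (2 * t)) := by ac_rfl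
      _ = 1 := by rw [mul_inv_cancel₀ (pow_ne_zero _ hvϖ.ne'), inv_mul_cancel₀ (pow_ne_zero _ hvϖ.ne'), one_mul]
      _ ≤ 1 := le_rfl
  -- (k4) `|Nx + wNy| = |ϖ|^{2t}`, whence `|D₀| = |ϖ|^{−2ρ}`
  have hk4 : σ x * x + w * (σ y * y) = -(w * f) * (σ x * x) + (w * (σ (x * ζ) * y'' + σ (σ (x * ζ) * y'')) + w * (σ y'' * y'')) := by
    have e : σ y * y = (σ x * x) * Nζ + (σ (x * ζ) * y'' + σ (σ (x * ζ) * y'')) + σ y'' * y'' := by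
      rw [hy, hNζ]; simp only [map_add, map_mul, hσ]; ring
    rw [e, show σ x * x + w * (σ x * x * Nζ + (σ (x * ζ) * y'' + σ (σ (x * ζ) * y'')) + σ y'' * y'') =
      (1 + w * Nζ) * (σ x * x) + (w * (σ (x * ζ) * y'' + σ (σ (x * ζ) * y'')) + w * (σ y'' * y'')) by ring, hε]
  have hvNx : Valued.v (σ x * x) = 1 := by rw [map_mul, hvσ, hx, one_mul]
  have hvmain : Valued.v (-(w * f) * (σ x * x)) = Valued.v ϖ ^ (2 * t) := by
    rw [map_mul, Valuation.map_neg, map_mul, hvw, hvf, hvNx, one_mul, mul_one]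
  have hvrest : Valued.v (w * (σ (x * ζ) * y'' + σ (σ (x * ζ) * y'')) + w * (σ y'' * y'')) < Valued.v ϖ ^ (2 * t) := by
    refine (Valuation.map_add _ _ _).trans_lt (max_lt ?_ ?_)
    · rw [map_mul, hvw, one_mul]
      refine (hTr _).trans_lt ?_
      rw [map_mul, hvσ, map_mul, hx, hζ, one_mul, one_mul, hy'']
      calc Valued.v ϖ * Valued.v ϖ ^ (2 * t) < 1 * Valued.v ϖ ^ (2 * t) := mul_lt_mul_of_pos_right hϖ1 (pow_pos hvϖ _)
        _ = Valued.v ϖ ^ (2 * t) := one_mul _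
    · rw [map_mul, hvw, one_mul, map_mul, hvσ, hy'', ← pow_add]
      exact pow_lt_pow_right_of_lt_one₀ hvϖ hϖ1 (by omega)
  have hvk4 : Valued.v (σ x * x + w * (σ y * y)) = Valued.v ϖ ^ (2 * t) := by
    rw [hk4, v_add_eq_of_lt (by rw [hvmain]; exact hvrest), hvmain]
  have hD₀eq : D₀ = -(D₁ * (σ x * x + w * (σ y * y))) := by rw [hD₀, hD₂]; ring
  have hvD₀ : Valued.v D₀ = (Valued.v ϖ ^ (2 * ρ))⁻¹ := by
    rw [hD₀eq, Valuation.map_neg, map_mul, hvD₁, hvk4, pow_add, mul_inv, mul_assoc, inv_mul_cancel₀ (pow_ne_zero _ hvϖ.ne'), mul_one]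
  have hD₀0 : D₀ ≠ 0 := fun h => by
    rw [h, map_zero] at hvD₀; exact (inv_ne_zero (pow_ne_zero _ hvϖ.ne')) hvD₀.symm
  -- the diagonal form
  let D : Fin 3 → K := ![D₀, D₁, D₂]
  have hD0 : D 0 = D₀ := rfl
  have hD1 : D 1 = D₁ := rfl
  have hD2 : D 2 = D₂ := rfl
  refine ⟨D, fun i => ?_, ?_⟩
  · fin_cases i
    · exact ⟨hσD₀, hD₀0⟩
    · exact ⟨hσD₁, hD₁0⟩
    · exact ⟨hσD₂, hD₂0⟩
  -- the Gram matrix and its integrality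
  have hG := formCongr_hnf_diagonal σ D x y (ϖ ^ ρ * ζ) (ϖ ^ ρ) (ϖ ^ c) V (by rw [hV])
  rw [hD0, hD1, hD2] at hG
  have hG00 : D₀ + σ x * D₁ * x + σ y * D₂ * y = 0 := by rw [hD₀]; ring
  have hvϖρ : Valued.v (ϖ ^ ρ) = Valued.v ϖ ^ ρ := map_pow _ _ _
  have hvσϖρ : Valued.v (σ (ϖ ^ ρ)) = Valued.v ϖ ^ ρ := by rw [hvσ, map_pow]
  have hvϖcK : Valued.v (ϖ ^ c) = Valued.v ϖ ^ c := map_pow _ _ _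
  have hpowle : ∀ n : ℕ, Valued.v ϖ ^ n ≤ 1 := fun n => pow_le_one₀ zero_le hϖ1'
  have hGint : IsIntMatrix (formCongr σ V (Matrix.diagonal D)) := by
    rw [hG]
    refine isIntMatrix_of_fin_three ?_ ?_ ?_ ?_ ?_ ?_ ?_ ?_ ?_
    · rw [hG00, map_zero]; exact zero_le
    · -- `G₀₁ = ϖ^ρ (D₁σx + D₂ζσy)`
      rw [show σ x * D₁ * ϖ ^ ρ + σ y * D₂ * (ϖ ^ ρ * ζ) = (D₁ * σ x + D₂ * ζ * σ y) * ϖ ^ ρ by ring, map_mul, hvϖρ]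
      exact hvk1
    · rw [map_mul, map_mul, hvσ, hvD₂, hvϖcK, mul_assoc, inv_mul_cancel₀ hvϖc, mul_one]; exact hvy
    · -- `G₁₀ = σ(ϖ^ρ)·σ(D₁σx + D₂ζσy)`
      have e : σ (ϖ ^ ρ) * D₁ * x + σ (ϖ ^ ρ * ζ) * D₂ * y = σ (ϖ ^ ρ) * σ (D₁ * σ x + D₂ * ζ * σ y) := by
        rw [map_add, map_mul, map_mul, map_mul, map_mul, hσ, hσ, hσD₁, hσD₂]; ring
      rw [e, map_mul, hvσϖρ, hvσ, mul_comm]; exact hvk1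
    · exact hvk2
    · rw [map_mul Valued.v (σ (ϖ ^ ρ * ζ) * D₂) (ϖ ^ c), map_mul Valued.v (σ (ϖ ^ ρ * ζ)) D₂, hvσ, map_mul Valued.v (ϖ ^ ρ) ζ, hvϖρ, hζ, mul_one,
        hvD₂, hvϖcK, mul_assoc, inv_mul_cancel₀ hvϖc, mul_one]; exact hpowle ρ
    · rw [map_mul, map_mul, hvσ, hvϖcK, hvD₂, mul_inv_cancel₀ hvϖc, one_mul]; exact hvy
    · rw [map_mul, map_mul, hvσ, hvϖcK, hvD₂, mul_inv_cancel₀ hvϖc, one_mul, map_mul, hvϖρ, hζ, mul_one]; exact hpowle ρ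
    · rw [map_mul, map_mul, hvσ, hvϖcK, hvD₂, mul_inv_cancel₀ hvϖc, one_mul]; exact hpowle c
  -- the determinant
  have hdet : Valued.v (formCongr σ V (Matrix.diagonal D)).det = 1 := by
    rw [det_formCongr_diagonal, det_coe_hnf x y (ϖ ^ ρ * ζ) (ϖ ^ ρ) (ϖ ^ c) V (by rw [hV]), hD0, hD1, hD2]
    simp only [map_mul, map_pow, hvσ, hvD₀, hvD₁, hvD₂]
    set A := Valued.v ϖ ^ ρ with hA
    set C := Valued.v ϖ ^ c with hC
    have hA0 : A ≠ 0 := pow_ne_zero _ hvϖ.ne'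
    have hC0 : C ≠ 0 := hvϖc
    have e2 : Valued.v ϖ ^ (2 * ρ) = A * A := by rw [hA, ← pow_add]; congr 1; ring
    rw [e2]
    calc A * C * ((A * A)⁻¹ * C⁻¹ * C⁻¹) * (A * C) = (A * A * (A * A)⁻¹) * (C * C⁻¹) * (C * C⁻¹) := by ac_rfl
      _ = 1 := by rw [mul_inv_cancel₀ (mul_ne_zero hA0 hA0), mul_inv_cancel₀ hC0, one_mul, one_mul]
  have hinv : IsIntMatrix (ϖ • (formCongr σ V (Matrix.diagonal D))⁻¹) := fun i j => by
    rw [Matrix.smul_apply, smul_eq_mul, map_mul]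
    exact mul_le_one' hϖ1' (isIntMatrix_nonsing_inv_of_v_det_eq_one hGint hdet i j)
  exact (isVertexLattice_latt_iff_of_v σ hvσ hϖ0 (Matrix.diagonal D) 0 V).2 ⟨hGint, hinv, by rw [hdet, pow_zero]⟩

/-- **THE CRITERION (R) FOR THE GLUED STRATA** (MEMO v2 §4 (G), SPEC B5 (i)): `latt (1 0 0; x ϖ^ρ 0; xζ+y″ ϖ^ρζ ϖ^{2ρ+2t})` with units `x, ζ`, `|y″| = |ϖ|^{2t}`,
`ρ, t ≥ 1`, is dualisable iff `ζσ(y″)∕σ(x)` is `σ`-fixed modulo `𝔭^{ρ+2t}`. [cite: Jacobowitz1962, §7] [cite: Kottwitz1986BaseChangeUnits, §1 pp. 240–241] -/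
theorem isDualisableLattice_latt_hnf_glued_iff {σ : K →+* K} (hσ : ∀ a, σ (σ a) = a) (hvσ : ∀ a, Valued.v (σ a) = Valued.v a)
    {ϖ : K} (hϖ0 : ϖ ≠ 0) (hϖ1 : Valued.v ϖ < 1) (hTr : ∀ a : K, Valued.v (a + σ a) ≤ Valued.v ϖ * Valued.v a)
    (ρ t : ℕ) (hρ : 1 ≤ ρ) (ht : 1 ≤ t) {x ζ y'' : K} (hx : Valued.v x = 1) (hζ : Valued.v ζ = 1) (hy'' : Valued.v y'' = Valued.v ϖ ^ (2 * t))
    (V : GL (Fin 3) K) (hV : (V : Matrix (Fin 3) (Fin 3) K) = !![1, 0, 0; x, ϖ ^ ρ, 0; x * ζ + y'', ϖ ^ ρ * ζ, ϖ ^ (2 * ρ + 2 * t)]) :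
    IsDualisableLattice σ ϖ (latt (V : Matrix (Fin 3) (Fin 3) K)) ↔ ∃ f : K, σ f = f ∧ Valued.v (ζ * σ y'' - σ x * f) ≤ Valued.v ϖ ^ (ρ + 2 * t) :=
  ⟨isDualisableLattice_latt_hnf_glued_imp hσ hvσ hϖ0 hϖ1.le ρ t hx hζ.le (by rw [hy'']; exact pow_le_one₀ zero_le hϖ1.le) V hV,
    fun ⟨_, hf, hR⟩ => isDualisableLattice_latt_hnf_glued_of hσ hvσ hϖ0 hϖ1 hTr ρ t hρ ht hx hζ hy'' V hV hf hR⟩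

end Summit.HodgeConjecture.HodgeConjecture.Cruxes.H413.F0P3cDyRamDiagonalGluedTubeCriterion

end
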